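import Summits.QuantumFields.BalabanUV.Beta.EriceFlowEnclosureB12AsPrintedHistoryContagionShiftFlowPicard

/-!
# Beta / EriceFlowEnclosureB12AsPrintedHistoryContagionShiftFlowRepin — ASYMPTOTIC FREEDOM IS CONTAGIOUS, part 23: RE-PINNING — UNIQUENESS AT THE REFERENCE PIN ITSELF,
# BY NODE U2's SHORT-MEMORY THEOREM ON THE ENVELOPE BOX.  Parts 10–22 asked every uniqueness ∕ well-posedness statement of a pin e STRICTLY BELOW the reference's pin g*
# (`e²·(1∕g*² + …) ≤ 3∕4`), so parts 19 ∕ 20 ∕ 22 carry TWO thresholds (existence at e, uniqueness only below ≈ 0.87·e).  This part removes the gap.  §29 — THE ENVELOPE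
# PRINCIPLE: two box solutions from ONE pin that stay below a common level f coincide as soon as `C_m f³ < (1 − θ)²∕2` — this is node U2's floor-free short-memory
# uniqueness `T4BetaFlowWellPosed.Sharpness.memFlow_unique_of_shortMemory_moment` (v1.3 §9) BY NAME on the box ]0, f] (`memoryProfile_mono`); the reference's ONLY job is to make
# box solutions enveloped.  §30 — THE CONTAGION WITH A FREE ENVELOPE: part 10's induction re-run with the envelope half-width a decoupled from the pin e
# (`4C_m a ≤ β*(1 − θ)`, `1∕(4a²) + 1∕g*² + K ≤ 1∕e² + 3∕(4t_a²)`, `K = C_mγ∕(1 − θ)² + (2C_m∕((1 − θ)β*))²` ⟹ `1∕(4a²) + (β*∕4)m ≤ 1∕h(m)²`; part 10 is a = e with the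
# reference's own `3∕(4t_a²)` thrown away).  §31 — AT THE REFERENCE PIN (e = g*, a = t_a): under `4C_m t_a ≤ β*(1 − θ)`, `t_a²K ≤ ½` EVERY box solution from g* stays
# below 2t_a with the profile `1∕(4t_a²) + (β*∕4)m`, and under `16C_m t_a³ < (1 − θ)²` it IS the reference: **the asymptotically free solution is the ONLY box solution from
# its own pin** (`memFlow_unique_at_reference`, `existsUnique_memFlow_at_reference`).  §32 — the same route sharpens part 10's different-pin uniqueness constant from
# `64C_m e³ ≤ (1 − θ)²` to `16C_m e³ < (1 − θ)²` and gives the θ-sharp form `4C_m e³ < (1 − √θ)²` (node U2's `…_sqrt`).  Parts 24–27 build on it: the reference is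
# Picard-computable at its own pin, the solution cocycle (re-pinning along the trajectory), eventual well-posedness along EVERY AF trajectory with no smallness at all,
# and ONE threshold on the carrier and for nearby functionals.
# Abstract in B (β-flow team, prover 1, unit `b2b-balaban-beta-bflow-p1`, gen 38; ROW AP-I·Uc × NODE U2)

HONEST FRAMING (page 1 of everything the β sub-cell writes): discharging `BetaPertH` makes Bałaban's UV stability UNCONDITIONAL — a
real constructive-QFT result; it is NOT the continuum limit and NOT the Clay problem.  HONEST DEPENDENCY (cell reorg 2026-08-19,
verbatim): «continuum YM on T⁴ ⇐ BetaPertH ∧ nine spine estimates (0/9 proved); BetaPertH ⇐ (D1) ∧ (D4) ∧ CAP+tail; G-an2-4 gates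
asym, D1 and NE2/3/4.»  THIS MODULE DISCHARGES NOTHING: [folklore] real analysis (part 10's strong induction with one more free parameter; a box restriction) over node
U2's HYPOTHESIS SHAPES `T4BetaStationary.{SeqBox, MemoryProfile}`, `T4BetaFlowWellPosed.{MemFlow, drive}` on an ABSTRACT functional `B : (ℕ → ℝ) → ℝ` — node U2's
hypothesis shapes, which node U2 derives for Bałaban's limit functional from NE4 ∕ moduli LETTERS (NOT PRINTED for [I] = T. Bałaban, Commun. Math. Phys. **109** (1987)
[Balaban1987RG1]: GAPS G-t4-U2-1 ∕ -2; the reference profile is the shape of (0.31)'s lower half, Theorem 2 p. 259, STATED WITHOUT PROOF, in the continuum; p. 298 says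
only that β_j depends on the preceding couplings).  Nothing of Bałaban's β is asserted; node U2's v1.3 §9 `Sharpness.memFlow_unique_of_shortMemory_moment ∕ _sqrt` and part 10's
`abs_drive_sub_drive_le_of_envelope ∕ le_two_mul_pin_of_reference_flow` are USED BY NAME; nothing of node U2's modules or of parts 1–22 is restated or modified.

WHAT THIS FILE PROVES (0 sorry, 0 def): §29 `memoryProfile_mono`, **`memFlow_unique_of_envelope`**, `memFlow_unique_of_envelope_sqrt`; §30 `base_lower_core`,
**`base_lower_of_envelope_pin`**, **`invSq_lower_of_reference_flow_pin`**, `le_two_mul_of_reference_flow_pin`; §31 **`invSq_lower_at_reference`**, `le_two_mul_at_reference`,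
`le_of_profile`, **`memFlow_unique_at_reference`**, `memFlow_unique_at_reference_sqrt`, **`existsUnique_memFlow_at_reference`**; §32 **`memFlow_unique_of_reference_sharp`**,
`memFlow_unique_of_reference_sqrt`.  NOT CLAIMED: anything about Bałaban's β; existence at the reference pin by Picard iteration (part 24); `BetaPertH`; the continuum limit
of the measures; Clay.
-/

namespace Summit.QuantumFields.BalabanUV.Beta.EriceFlowEnclosureB12AsPrintedHistoryContagionShiftFlowRepin

open Finset Filter Topology
open Literature.MathematicalPhysics.QuantumFieldTheory.Balaban1983to89
open Literature.MathematicalPhysics.QuantumFieldTheory.Balaban1983to89.T4CouplingMatching (prof sprof sprof_pos sprof_sq prof_pos)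
open Literature.MathematicalPhysics.QuantumFieldTheory.Balaban1983to89.T4BetaStationary (SeqBox MemoryProfile)
open Literature.MathematicalPhysics.QuantumFieldTheory.Balaban1983to89.T4BetaFlowWellPosed (MemFlow drive invSq_eq_of_memFlow)
open Literature.MathematicalPhysics.QuantumFieldTheory.Balaban1983to89.T4BetaFlowWellPosed.Sharpness (memFlow_unique_of_shortMemory_moment
  memFlow_unique_of_shortMemory_sqrt)
open Summit.QuantumFields.BalabanUV.Beta.EriceFlowEnclosureB12AsPrintedHistoryContagion (mul_sprof_le)
open Summit.QuantumFields.BalabanUV.Beta.EriceFlowEnclosureB12AsPrintedHistoryContagionProfile (le_two_mul_of_profile)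
open Summit.QuantumFields.BalabanUV.Beta.EriceFlowEnclosureB12AsPrintedHistoryContagionShiftFlow (le_invSprof_of_prof_le abs_drive_sub_drive_le_of_envelope
  le_two_mul_pin_of_reference_flow)

noncomputable section

/-! ## §29 The envelope principle: uniqueness below a common level is node U2's short-memory theorem on the envelope box -/

/-- A memory profile on the box ]0, γ]^ℕ is a memory profile on every smaller box ]0, f]^ℕ, f ≤ γ (same constants). [folklore] -/
theorem memoryProfile_mono {B : (ℕ → ℝ) → ℝ} {Cm θ γ f : ℝ} (hB : MemoryProfile Cm θ γ B) (hfγ : f ≤ γ) : MemoryProfile Cm θ f B :=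
  fun u u' hu hu' => hB u u' (fun j => ⟨(hu j).1, (hu j).2.trans hfγ⟩) (fun j => ⟨(hu' j).1, (hu' j).2.trans hfγ⟩)

/-- **THE ENVELOPE PRINCIPLE.**  `B` with memory profile `(C_m, θ)` on ]0, γ]^ℕ (0 ≤ θ < 1, C_m ≥ 0); two box solutions h, h′ of the flow with memory from ONE pin e
(`MemFlow B e ·`) that stay below a common level f at every scale; `C_m f³ < (1 − θ)²∕2`.  THEN `h = h′` — NO reference, NO floor, NO sign, the box γ ARBITRARY: both are
box solutions in ]0, min(f, γ)]^ℕ, where node U2's floor-free short-memory uniqueness `memFlow_unique_of_shortMemory_moment` (first-moment form `C_m·γ′³ < (1 − θ)²∕2`)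
applies.  The reference solutions of parts 10–22 serve ONLY to produce such an envelope (contagion). [folklore] -/
theorem memFlow_unique_of_envelope {B : (ℕ → ℝ) → ℝ} {Cm θ γ e f : ℝ} {h h' : ℕ → ℝ}
    (hB : MemoryProfile Cm θ γ B) (hCm : 0 ≤ Cm) (hθ0 : 0 ≤ θ) (hθ1 : θ < 1)
    (hhs : SeqBox γ h) (hhs' : SeqBox γ h') (hhf : MemFlow B e h) (hhf' : MemFlow B e h')
    (henv : ∀ q, h q ≤ f) (henv' : ∀ q, h' q ≤ f) (hsmall : Cm * f ^ 3 < (1 - θ) ^ 2 / 2) : h = h' := by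
  rcases le_or_gt f γ with hfγ | hγf
  · exact memFlow_unique_of_shortMemory_moment (memoryProfile_mono hB hfγ) hCm hθ0 hθ1 hsmall
      (fun j => ⟨(hhs j).1, henv j⟩) (fun j => ⟨(hhs' j).1, henv' j⟩) hhf hhf'
  · have hγ : 0 ≤ γ := (hhs 0).1.le.trans (hhs 0).2
    have hγ3 : Cm * γ ^ 3 < (1 - θ) ^ 2 / 2 :=
      (mul_le_mul_of_nonneg_left (pow_le_pow_left₀ hγ hγf.le 3) hCm).trans_lt hsmall
    exact memFlow_unique_of_shortMemory_moment hB hCm hθ0 hθ1 hγ3 hhs hhs' hhf hhf'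

/-- THE ENVELOPE PRINCIPLE, θ-SHARP FORM (0 < θ < 1): `C_m f³ < 2(1 − √θ)²` suffices (node U2's `memFlow_unique_of_shortMemory_sqrt` on the envelope box; prover 2's
gen 45 shows the constant `2(1 − √θ)²` is the edge of the comparison method). [folklore] -/
theorem memFlow_unique_of_envelope_sqrt {B : (ℕ → ℝ) → ℝ} {Cm θ γ e f : ℝ} {h h' : ℕ → ℝ}
    (hB : MemoryProfile Cm θ γ B) (hCm : 0 ≤ Cm) (hθ0 : 0 < θ) (hθ1 : θ < 1)
    (hhs : SeqBox γ h) (hhs' : SeqBox γ h') (hhf : MemFlow B e h) (hhf' : MemFlow B e h')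
    (henv : ∀ q, h q ≤ f) (henv' : ∀ q, h' q ≤ f) (hsmall : Cm * f ^ 3 < 2 * (1 - Real.sqrt θ) ^ 2) : h = h' := by
  rcases le_or_gt f γ with hfγ | hγf
  · exact memFlow_unique_of_shortMemory_sqrt (memoryProfile_mono hB hfγ) hCm hθ0 hθ1 hsmall
      (fun j => ⟨(hhs j).1, henv j⟩) (fun j => ⟨(hhs' j).1, henv' j⟩) hhf hhf'
  · have hγ : 0 ≤ γ := (hhs 0).1.le.trans (hhs 0).2
    have hγ3 : Cm * γ ^ 3 < 2 * (1 - Real.sqrt θ) ^ 2 :=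
      (mul_le_mul_of_nonneg_left (pow_le_pow_left₀ hγ hγf.le 3) hCm).trans_lt hsmall
    exact memFlow_unique_of_shortMemory_sqrt hB hCm hθ0 hθ1 hγ3 hhs hhs' hhf hhf'

/-! ## §30 The contagion with a free envelope: the half-width a decoupled from the pin e -/

/-- **THE CORE INEQUALITY** (part 10's induction step with a free envelope).  `B` with memory profile `(C_m, θ)` on ]0, γ]^ℕ; ONE box solution t of `MemFlow B g* t` with
the AF profile `1∕t_a² + β*·m ≤ 1∕t(m)²`; a box history v below 2a at the scales `q < m`; the half-width a with `4C_m a ≤ β*(1 − θ)` and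
`1∕(4a²) + 1∕g*² + C_mγ∕(1 − θ)² + (2C_m∕((1 − θ)β*))² ≤ 1∕e² + 3∕(4t_a²)` (e any real).  THEN `1∕(4a²) + (β*∕4)m ≤ 1∕e² + drive B v m` (part 10's
`abs_drive_sub_drive_le_of_envelope` against t; `c√P ≤ c² + P∕4` absorbs the telescoped profile, keeping `3∕(4t_a²)` instead of discarding it).
[cite: Balaban1987RG1, Thm 2 (0.31) p.259 with (0.20) p.256 and p.298] -/
theorem base_lower_core {B : (ℕ → ℝ) → ℝ} {Cm θ γ bs ta gs e a : ℝ} {t v : ℕ → ℝ}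
    (hB : MemoryProfile Cm θ γ B) (hCm : 0 ≤ Cm) (hθ0 : 0 ≤ θ) (hθ1 : θ < 1) (hbs : 0 < bs) (hta : 0 < ta)
    (hts : SeqBox γ t) (htf : MemFlow B gs t) (hprof : ∀ m : ℕ, 1 / ta ^ 2 + bs * (m : ℝ) ≤ 1 / (t m) ^ 2)
    (ha : 0 < a) (hvs : SeqBox γ v) {m : ℕ} (henv : ∀ q, q < m → v q ≤ 2 * a)
    (hs1 : 4 * Cm * a ≤ bs * (1 - θ))
    (hs2 : 1 / (4 * a ^ 2) + (1 / gs ^ 2 + Cm * γ / (1 - θ) ^ 2 + (2 * Cm / ((1 - θ) * bs)) ^ 2) ≤ 1 / e ^ 2 + 3 / (4 * ta ^ 2)) :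
    1 / (4 * a ^ 2) + bs / 4 * (m : ℝ) ≤ 1 / e ^ 2 + drive B v m := by
  have h1θ : 0 < 1 - θ := by linarith
  have htprof : ∀ q : ℕ, t q ≤ 1 / sprof ta bs q := fun q => le_invSprof_of_prof_le hta hbs.le (hts q).1 (hprof q)
  have hD := abs_drive_sub_drive_le_of_envelope hB hCm hθ0 hθ1 hbs hta (by positivity : (0 : ℝ) ≤ 2 * a) hvs hts htprof henv
  have hy : 1 / (t m) ^ 2 = 1 / gs ^ 2 + drive B t m := invSq_eq_of_memFlow htf m
  have hyt : 1 / ta ^ 2 + bs * (m : ℝ) - 1 / gs ^ 2 ≤ drive B t m := by linarith [hprof m]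
  have hab := mul_sprof_le hta hbs.le (2 * Cm / ((1 - θ) * bs)) m
  have hprofm : prof ta bs m = 1 / ta ^ 2 + bs * (m : ℝ) := rfl
  have hlin : Cm / (1 - θ) * (2 * a) ≤ bs / 2 := by
    rw [div_mul_eq_mul_div, div_le_iff₀ h1θ]; linarith
  have hlin' : Cm / (1 - θ) * (2 * a * (m : ℝ)) ≤ bs / 2 * (m : ℝ) := by
    calc Cm / (1 - θ) * (2 * a * (m : ℝ)) = Cm / (1 - θ) * (2 * a) * (m : ℝ) := by ring
      _ ≤ bs / 2 * (m : ℝ) := mul_le_mul_of_nonneg_right hlin (Nat.cast_nonneg m)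
  have hsq : Cm / (1 - θ) * (2 / bs * sprof ta bs m) = 2 * Cm / ((1 - θ) * bs) * sprof ta bs m := by
    field_simp
  have hDle := (abs_sub_le_iff.mp hD).2
  have hdist : Cm / (1 - θ) * (2 * a * (m : ℝ) + 2 / bs * sprof ta bs m)
      = Cm / (1 - θ) * (2 * a * (m : ℝ)) + Cm / (1 - θ) * (2 / bs * sprof ta bs m) := mul_add _ _ _
  have e34 : 3 / (4 * ta ^ 2) = 3 / 4 * (1 / ta ^ 2) := by ring
  rw [hprofm] at hab
  linarith [hyt, hDle, hab, hlin', hsq, hdist, e34]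

/-- **THE BASE PROPERTY WITH A FREE ENVELOPE**: under the data of `base_lower_core`, every box history v below 2a EVERYWHERE has `1∕(4a²) + (β*∕4)m ≤ 1∕e² + drive B v m`
at every scale m (part 12's `base_lower_of_envelope` is the case a = e). [cite: Balaban1987RG1, Thm 2 (0.31) p.259 with (0.20) p.256 and p.298] -/
theorem base_lower_of_envelope_pin {B : (ℕ → ℝ) → ℝ} {Cm θ γ bs ta gs e a : ℝ} {t v : ℕ → ℝ}
    (hB : MemoryProfile Cm θ γ B) (hCm : 0 ≤ Cm) (hθ0 : 0 ≤ θ) (hθ1 : θ < 1) (hbs : 0 < bs) (hta : 0 < ta)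
    (hts : SeqBox γ t) (htf : MemFlow B gs t) (hprof : ∀ m : ℕ, 1 / ta ^ 2 + bs * (m : ℝ) ≤ 1 / (t m) ^ 2)
    (ha : 0 < a) (hvs : SeqBox γ v) (henv : ∀ q, v q ≤ 2 * a)
    (hs1 : 4 * Cm * a ≤ bs * (1 - θ))
    (hs2 : 1 / (4 * a ^ 2) + (1 / gs ^ 2 + Cm * γ / (1 - θ) ^ 2 + (2 * Cm / ((1 - θ) * bs)) ^ 2) ≤ 1 / e ^ 2 + 3 / (4 * ta ^ 2)) (m : ℕ) :
    1 / (4 * a ^ 2) + bs / 4 * (m : ℝ) ≤ 1 / e ^ 2 + drive B v m :=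
  base_lower_core hB hCm hθ0 hθ1 hbs hta hts htf hprof ha hvs (fun q _ => henv q) hs1 hs2

/-- **THE CONTAGION WITH A FREE ENVELOPE.**  `B` with memory profile `(C_m, θ)` on ]0, γ]^ℕ; ONE box solution t of `MemFlow B g* t` with `1∕t_a² + β*·m ≤ 1∕t(m)²`; ANY box
solution h of `MemFlow B e h`; a half-width a > 0 with `4C_m a ≤ β*(1 − θ)` and `1∕(4a²) + 1∕g*² + C_mγ∕(1 − θ)² + (2C_m∕((1 − θ)β*))² ≤ 1∕e² + 3∕(4t_a²)`.  THEN
**`1∕(4a²) + (β*∕4)m ≤ 1∕h(m)²`** at every scale (strong induction on m; part 10's `invSq_lower_of_reference_flow` is a = e). [cite: Balaban1987RG1, Thm 2 (0.31) p.259 with (0.20) p.256 and p.298] -/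
theorem invSq_lower_of_reference_flow_pin {B : (ℕ → ℝ) → ℝ} {Cm θ γ bs ta gs e a : ℝ} {t h : ℕ → ℝ}
    (hB : MemoryProfile Cm θ γ B) (hCm : 0 ≤ Cm) (hθ0 : 0 ≤ θ) (hθ1 : θ < 1) (hbs : 0 < bs) (hta : 0 < ta)
    (hts : SeqBox γ t) (htf : MemFlow B gs t) (hprof : ∀ m : ℕ, 1 / ta ^ 2 + bs * (m : ℝ) ≤ 1 / (t m) ^ 2)
    (hhs : SeqBox γ h) (hhf : MemFlow B e h) (ha : 0 < a)
    (hs1 : 4 * Cm * a ≤ bs * (1 - θ))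
    (hs2 : 1 / (4 * a ^ 2) + (1 / gs ^ 2 + Cm * γ / (1 - θ) ^ 2 + (2 * Cm / ((1 - θ) * bs)) ^ 2) ≤ 1 / e ^ 2 + 3 / (4 * ta ^ 2)) :
    ∀ m : ℕ, 1 / (4 * a ^ 2) + bs / 4 * (m : ℝ) ≤ 1 / (h m) ^ 2 := by
  intro m
  induction m using Nat.strong_induction_on with
  | _ m ih =>
    have henv : ∀ q, q < m → h q ≤ 2 * a := fun q hq =>
      le_two_mul_of_profile hbs.le ha (hhs q).1 (Nat.cast_nonneg q) (ih q hq)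
    rw [invSq_eq_of_memFlow hhf m]
    exact base_lower_core hB hCm hθ0 hθ1 hbs hta hts htf hprof ha hhs henv hs1 hs2

/-- … hence **every such box solution stays below 2a**: `h(m) ≤ 2a` for all m. [folklore] -/
theorem le_two_mul_of_reference_flow_pin {B : (ℕ → ℝ) → ℝ} {Cm θ γ bs ta gs e a : ℝ} {t h : ℕ → ℝ}
    (hB : MemoryProfile Cm θ γ B) (hCm : 0 ≤ Cm) (hθ0 : 0 ≤ θ) (hθ1 : θ < 1) (hbs : 0 < bs) (hta : 0 < ta)
    (hts : SeqBox γ t) (htf : MemFlow B gs t) (hprof : ∀ m : ℕ, 1 / ta ^ 2 + bs * (m : ℝ) ≤ 1 / (t m) ^ 2)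
    (hhs : SeqBox γ h) (hhf : MemFlow B e h) (ha : 0 < a)
    (hs1 : 4 * Cm * a ≤ bs * (1 - θ))
    (hs2 : 1 / (4 * a ^ 2) + (1 / gs ^ 2 + Cm * γ / (1 - θ) ^ 2 + (2 * Cm / ((1 - θ) * bs)) ^ 2) ≤ 1 / e ^ 2 + 3 / (4 * ta ^ 2)) :
    ∀ m : ℕ, h m ≤ 2 * a := fun m =>
  le_two_mul_of_profile hbs.le ha (hhs m).1 (Nat.cast_nonneg m)
    (invSq_lower_of_reference_flow_pin hB hCm hθ0 hθ1 hbs hta hts htf hprof hhs hhf ha hs1 hs2 m)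

/-! ## §31 At the reference pin: every box solution from g* is enveloped by 2t_a, and it is the reference -/

/-- **THE CONTAGION AT THE REFERENCE PIN.**  `B` with memory profile `(C_m, θ)` on ]0, γ]^ℕ; ONE box solution t of `MemFlow B g* t` with `1∕t_a² + β*·m ≤ 1∕t(m)²`
(β* > 0, t_a > 0); the reference scale t_a small: `4C_m t_a ≤ β*(1 − θ)` and `t_a²·(C_mγ∕(1 − θ)² + (2C_m∕((1 − θ)β*))²) ≤ ½`.  THEN EVERY box solution h of the flow from
the SAME pin g* obeys `1∕(4t_a²) + (β*∕4)m ≤ 1∕h(m)²` at every scale (§30 with e = g*, a = t_a: the terms `1∕g*²` cancel and the reference's own `3∕(4t_a²)` pays for the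
envelope). [cite: Balaban1987RG1, Thm 2 (0.31) p.259 with (0.20) p.256 and p.298] -/
theorem invSq_lower_at_reference {B : (ℕ → ℝ) → ℝ} {Cm θ γ bs ta gs : ℝ} {t h : ℕ → ℝ}
    (hB : MemoryProfile Cm θ γ B) (hCm : 0 ≤ Cm) (hθ0 : 0 ≤ θ) (hθ1 : θ < 1) (hbs : 0 < bs) (hta : 0 < ta)
    (hts : SeqBox γ t) (htf : MemFlow B gs t) (hprof : ∀ m : ℕ, 1 / ta ^ 2 + bs * (m : ℝ) ≤ 1 / (t m) ^ 2)
    (hhs : SeqBox γ h) (hhf : MemFlow B gs h)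
    (hr1 : 4 * Cm * ta ≤ bs * (1 - θ))
    (hr2 : ta ^ 2 * (Cm * γ / (1 - θ) ^ 2 + (2 * Cm / ((1 - θ) * bs)) ^ 2) ≤ 1 / 2) :
    ∀ m : ℕ, 1 / (4 * ta ^ 2) + bs / 4 * (m : ℝ) ≤ 1 / (h m) ^ 2 := by
  refine invSq_lower_of_reference_flow_pin hB hCm hθ0 hθ1 hbs hta hts htf hprof hhs hhf hta hr1 ?_
  have hK : Cm * γ / (1 - θ) ^ 2 + (2 * Cm / ((1 - θ) * bs)) ^ 2 ≤ 1 / (2 * ta ^ 2) := by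
    rw [le_div_iff₀ (by positivity)]; linarith
  have e1 : 1 / (4 * ta ^ 2) + 1 / (2 * ta ^ 2) = 3 / (4 * ta ^ 2) := by
    field_simp; ring
  linarith

/-- … hence **every box solution from the reference pin stays below 2t_a**. [folklore] -/
theorem le_two_mul_at_reference {B : (ℕ → ℝ) → ℝ} {Cm θ γ bs ta gs : ℝ} {t h : ℕ → ℝ}
    (hB : MemoryProfile Cm θ γ B) (hCm : 0 ≤ Cm) (hθ0 : 0 ≤ θ) (hθ1 : θ < 1) (hbs : 0 < bs) (hta : 0 < ta)
    (hts : SeqBox γ t) (htf : MemFlow B gs t) (hprof : ∀ m : ℕ, 1 / ta ^ 2 + bs * (m : ℝ) ≤ 1 / (t m) ^ 2)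
    (hhs : SeqBox γ h) (hhf : MemFlow B gs h)
    (hr1 : 4 * Cm * ta ≤ bs * (1 - θ))
    (hr2 : ta ^ 2 * (Cm * γ / (1 - θ) ^ 2 + (2 * Cm / ((1 - θ) * bs)) ^ 2) ≤ 1 / 2) :
    ∀ m : ℕ, h m ≤ 2 * ta := fun m =>
  le_two_mul_of_profile hbs.le hta (hhs m).1 (Nat.cast_nonneg m)
    (invSq_lower_at_reference hB hCm hθ0 hθ1 hbs hta hts htf hprof hhs hhf hr1 hr2 m)

/-- From the profile to the level: `1∕t_a² + β*·m ≤ 1∕x²` (β* ≥ 0, x > 0, t_a > 0) ⟹ `x ≤ t_a`. [folklore] -/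
theorem le_of_profile {ta bs x : ℝ} {m : ℕ} (hta : 0 < ta) (hbs : 0 ≤ bs) (hx : 0 < x)
    (h : 1 / ta ^ 2 + bs * (m : ℝ) ≤ 1 / x ^ 2) : x ≤ ta := by
  have h2 : 1 / ta ^ 2 ≤ 1 / x ^ 2 := by linarith [mul_nonneg hbs (Nat.cast_nonneg m)]
  have h3 : x ^ 2 ≤ ta ^ 2 := (one_div_le_one_div (by positivity) (pow_pos hx 2)).mp h2
  exact (pow_le_pow_iff_left₀ hx.le hta.le two_ne_zero).mp h3

/-- **UNIQUENESS AT THE REFERENCE PIN.**  `B` with memory profile `(C_m, θ)` on ]0, γ]^ℕ (0 ≤ θ < 1, C_m ≥ 0); ONE box solution t of `MemFlow B g* t` with the AF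
profile `1∕t_a² + β*·m ≤ 1∕t(m)²` (β* > 0, t_a > 0) whose reference scale is small: `4C_m t_a ≤ β*(1 − θ)`, `t_a²·(C_mγ∕(1 − θ)² + (2C_m∕((1 − θ)β*))²) ≤ ½`,
`16C_m t_a³ < (1 − θ)²`.  THEN **every box solution of the flow from the pin g* IS t** — the envelope principle on ]0, 2t_a] (t ≤ t_a by its profile, h ≤ 2t_a by
`le_two_mul_at_reference`; `C_m(2t_a)³ < (1 − θ)²∕2`).  Parts 10 ∕ 13 required the competing pin strictly below g*; nothing of the kind is asked here.
[cite: Balaban1987RG1, Thm 2 (0.31) p.259 with (0.20) p.256 and p.298] -/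
theorem memFlow_unique_at_reference {B : (ℕ → ℝ) → ℝ} {Cm θ γ bs ta gs : ℝ} {t h : ℕ → ℝ}
    (hB : MemoryProfile Cm θ γ B) (hCm : 0 ≤ Cm) (hθ0 : 0 ≤ θ) (hθ1 : θ < 1) (hbs : 0 < bs) (hta : 0 < ta)
    (hts : SeqBox γ t) (htf : MemFlow B gs t) (hprof : ∀ m : ℕ, 1 / ta ^ 2 + bs * (m : ℝ) ≤ 1 / (t m) ^ 2)
    (hhs : SeqBox γ h) (hhf : MemFlow B gs h)
    (hr1 : 4 * Cm * ta ≤ bs * (1 - θ))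
    (hr2 : ta ^ 2 * (Cm * γ / (1 - θ) ^ 2 + (2 * Cm / ((1 - θ) * bs)) ^ 2) ≤ 1 / 2)
    (hr4 : 16 * Cm * ta ^ 3 < (1 - θ) ^ 2) : h = t := by
  have henv := le_two_mul_at_reference hB hCm hθ0 hθ1 hbs hta hts htf hprof hhs hhf hr1 hr2
  have htenv : ∀ q, t q ≤ 2 * ta := fun q =>
    (le_of_profile hta hbs.le (hts q).1 (hprof q)).trans (by linarith)
  exact memFlow_unique_of_envelope hB hCm hθ0 hθ1 hhs hts hhf htf henv htenv (by nlinarith)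

/-- UNIQUENESS AT THE REFERENCE PIN, θ-SHARP FORM (0 < θ < 1): `4C_m t_a³ < (1 − √θ)²` replaces `16C_m t_a³ < (1 − θ)²`. [cite: Balaban1987RG1, Thm 2 (0.31) p.259 with (0.20) p.256 and p.298] -/
theorem memFlow_unique_at_reference_sqrt {B : (ℕ → ℝ) → ℝ} {Cm θ γ bs ta gs : ℝ} {t h : ℕ → ℝ}
    (hB : MemoryProfile Cm θ γ B) (hCm : 0 ≤ Cm) (hθ0 : 0 < θ) (hθ1 : θ < 1) (hbs : 0 < bs) (hta : 0 < ta)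
    (hts : SeqBox γ t) (htf : MemFlow B gs t) (hprof : ∀ m : ℕ, 1 / ta ^ 2 + bs * (m : ℝ) ≤ 1 / (t m) ^ 2)
    (hhs : SeqBox γ h) (hhf : MemFlow B gs h)
    (hr1 : 4 * Cm * ta ≤ bs * (1 - θ))
    (hr2 : ta ^ 2 * (Cm * γ / (1 - θ) ^ 2 + (2 * Cm / ((1 - θ) * bs)) ^ 2) ≤ 1 / 2)
    (hr4 : 4 * Cm * ta ^ 3 < (1 - Real.sqrt θ) ^ 2) : h = t := by
  have henv := le_two_mul_at_reference hB hCm hθ0.le hθ1 hbs hta hts htf hprof hhs hhf hr1 hr2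
  have htenv : ∀ q, t q ≤ 2 * ta := fun q =>
    (le_of_profile hta hbs.le (hts q).1 (hprof q)).trans (by linarith)
  exact memFlow_unique_of_envelope_sqrt hB hCm hθ0 hθ1 hhs hts hhf htf henv htenv (by nlinarith)

/-- **WELL-POSEDNESS AT THE REFERENCE PIN**: under the data of `memFlow_unique_at_reference` the flow with memory from g* has EXACTLY ONE box solution in ]0, γ]^ℕ — the
reference itself. [cite: Balaban1987RG1, Thm 2 (0.31) p.259 with (0.20) p.256 and p.298] -/
theorem existsUnique_memFlow_at_reference {B : (ℕ → ℝ) → ℝ} {Cm θ γ bs ta gs : ℝ} {t : ℕ → ℝ}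
    (hB : MemoryProfile Cm θ γ B) (hCm : 0 ≤ Cm) (hθ0 : 0 ≤ θ) (hθ1 : θ < 1) (hbs : 0 < bs) (hta : 0 < ta)
    (hts : SeqBox γ t) (htf : MemFlow B gs t) (hprof : ∀ m : ℕ, 1 / ta ^ 2 + bs * (m : ℝ) ≤ 1 / (t m) ^ 2)
    (hr1 : 4 * Cm * ta ≤ bs * (1 - θ))
    (hr2 : ta ^ 2 * (Cm * γ / (1 - θ) ^ 2 + (2 * Cm / ((1 - θ) * bs)) ^ 2) ≤ 1 / 2)
    (hr4 : 16 * Cm * ta ^ 3 < (1 - θ) ^ 2) : ∃! h : ℕ → ℝ, SeqBox γ h ∧ MemFlow B gs h :=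
  ⟨t, ⟨hts, htf⟩, fun _ hh => memFlow_unique_at_reference hB hCm hθ0 hθ1 hbs hta hts htf hprof hh.1 hh.2 hr1 hr2 hr4⟩

/-! ## §32 The sharper different-pin uniqueness: part 10's binders with the contraction constant divided by four -/

/-- **PART 10's UNIQUENESS WITH `16C_m e³ < (1 − θ)²` IN PLACE OF `64C_m e³ ≤ (1 − θ)²`.**  `B` with memory profile `(C_m, θ)` on ]0, γ]^ℕ; ONE box solution t of
`MemFlow B g* t` with `1∕t_a² + β*·m ≤ 1∕t(m)²`; two box solutions h, h′ of `MemFlow B e ·` with `4C_m e ≤ β*(1 − θ)`, `e²·(1∕g*² + C_mγ∕(1 − θ)² + (2C_m∕((1 − θ)β*))²) ≤ 3∕4`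
and `16C_m e³ < (1 − θ)²`.  THEN `h = h′`: both stay below 2e (part 10's `le_two_mul_pin_of_reference_flow`), and the envelope principle on ]0, 2e] closes
(`C_m(2e)³ < (1 − θ)²∕2`) — node U2's v1.3 §9 in place of part 10's θ₁-weighted propagation. [cite: Balaban1987RG1, Thm 2 (0.31) p.259 with (0.20) p.256 and p.298] -/
theorem memFlow_unique_of_reference_sharp {B : (ℕ → ℝ) → ℝ} {Cm θ γ bs ta gs e : ℝ} {t h h' : ℕ → ℝ}
    (hB : MemoryProfile Cm θ γ B) (hCm : 0 ≤ Cm) (hθ0 : 0 ≤ θ) (hθ1 : θ < 1) (hbs : 0 < bs) (hta : 0 < ta)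
    (hts : SeqBox γ t) (htf : MemFlow B gs t) (hprof : ∀ m : ℕ, 1 / ta ^ 2 + bs * (m : ℝ) ≤ 1 / (t m) ^ 2)
    (hhs : SeqBox γ h) (hhf : MemFlow B e h) (hhs' : SeqBox γ h') (hhf' : MemFlow B e h')
    (hs1 : 4 * Cm * e ≤ bs * (1 - θ))
    (hs2 : e ^ 2 * (1 / gs ^ 2 + Cm * γ / (1 - θ) ^ 2 + (2 * Cm / ((1 - θ) * bs)) ^ 2) ≤ 3 / 4)
    (hs4 : 16 * Cm * e ^ 3 < (1 - θ) ^ 2) : h = h' := by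
  have henv := le_two_mul_pin_of_reference_flow hB hCm hθ0 hθ1 hbs hta hts htf hprof hhs hhf hs1 hs2
  have henv' := le_two_mul_pin_of_reference_flow hB hCm hθ0 hθ1 hbs hta hts htf hprof hhs' hhf' hs1 hs2
  exact memFlow_unique_of_envelope hB hCm hθ0 hθ1 hhs hhs' hhf hhf' henv henv' (by nlinarith)

/-- PART 10's UNIQUENESS, θ-SHARP FORM (0 < θ < 1): `4C_m e³ < (1 − √θ)²` in place of `64C_m e³ ≤ (1 − θ)²`. [cite: Balaban1987RG1, Thm 2 (0.31) p.259 with (0.20) p.256 and p.298] -/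
theorem memFlow_unique_of_reference_sqrt {B : (ℕ → ℝ) → ℝ} {Cm θ γ bs ta gs e : ℝ} {t h h' : ℕ → ℝ}
    (hB : MemoryProfile Cm θ γ B) (hCm : 0 ≤ Cm) (hθ0 : 0 < θ) (hθ1 : θ < 1) (hbs : 0 < bs) (hta : 0 < ta)
    (hts : SeqBox γ t) (htf : MemFlow B gs t) (hprof : ∀ m : ℕ, 1 / ta ^ 2 + bs * (m : ℝ) ≤ 1 / (t m) ^ 2)
    (hhs : SeqBox γ h) (hhf : MemFlow B e h) (hhs' : SeqBox γ h') (hhf' : MemFlow B e h')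
    (hs1 : 4 * Cm * e ≤ bs * (1 - θ))
    (hs2 : e ^ 2 * (1 / gs ^ 2 + Cm * γ / (1 - θ) ^ 2 + (2 * Cm / ((1 - θ) * bs)) ^ 2) ≤ 3 / 4)
    (hs4 : 4 * Cm * e ^ 3 < (1 - Real.sqrt θ) ^ 2) : h = h' := by
  have henv := le_two_mul_pin_of_reference_flow hB hCm hθ0.le hθ1 hbs hta hts htf hprof hhs hhf hs1 hs2
  have henv' := le_two_mul_pin_of_reference_flow hB hCm hθ0.le hθ1 hbs hta hts htf hprof hhs' hhf' hs1 hs2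
  exact memFlow_unique_of_envelope_sqrt hB hCm hθ0 hθ1 hhs hhs' hhf hhf' henv henv' (by nlinarith)

end

end Summit.QuantumFields.BalabanUV.Beta.EriceFlowEnclosureB12AsPrintedHistoryContagionShiftFlowRepin
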